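import Mathlib
import Summits.ValiantsHypothesis.ValiantsHypothesis.Theorems.SymmetroidPencilBasics
import Literature.Analysis.Matrix.DeterminantDefectInequality

/-!
# `MatrixDescartes` (stmt-ValiantsHypothesis-18050, V1) — line «negsquares» ported: R1, the EXTREME-EXPONENT rung of the
# `κ = 1` law — `e ≤ min d` or `e ≥ max d` ⇒ at most ONE positive zero, for every `m` and every `K`

HONEST FRAMING.  Helper port (`--supports stmt-ValiantsHypothesis-18050 --as helper`; val-lit port pool, seat val-port-3 g0;
CLAIM-FIRST #5 on the val-lit bus) of §R1 (lines 216–477) of the crux workfile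
`Cruxes/MatrixDescartes/Lines/negsquares_tropical.lean` (val-idea-6 g7, sha16 `29181cddc83b828e`; val-idea-crit-1 NOTE
#47/#48 READ, val-idea-crit-2 VERDICT #37 = PASS, structure/support tier, 0 seats), token-for-token up to: namespace out
of `Cruxes.…NegSquaresTropical` into `…Theorems.LacunarySymmetroidMatrixDescartes.NegSquaresTropical`; the workfile's
`Theses.LacunarySymmetroid` import DROPPED (nothing in §R1 uses it); eleven one-line docstrings added.  One definition
(`qPart`, the rescaled PSD part — review lane), no named facts, nothing admitted.  Support-tier kernel rows for the
negsquares line: the line's LAW (`NegSquaresLaw`, critic #36 PWP, 0 provers) and the located candidate `OneLawSharp` are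
untouched; nothing bears on the crux `…Theses.LacunarySymmetroid.MatrixDescartes`, on Conjecture B, or on `VP ≠ VNP`
(NOT proved).

CONTENTS (memo §5 of the line).  For PSD letters `P l` at exponents `d l` and one subtracted square `X^e • wwᵀ`:
`qPart` (`Q(t) = Σ t^{d l − e} P l`) and its quadratic-form / kernel / Loewner-monotonicity lemmas; the engine
`det_qPart_sub_eq_zero_between` (zeros of `det(Q(t) − wwᵀ)` on `(0, ∞)` form an interval: matrix determinant lemma
`Literature.Analysis.Matrix.det_sub_vecMulVec` + monotone `wᵀQ⁻¹w` via `dotProduct_inv_mulVec_le`, common-kernel vector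
in the semidefinite case); `card_posRoots_le_one_of_between`; the evaluation lemmas; and
★ `extremeExponent_le_one` — if `e ≤ d l` for all `l` or `d l ≤ e` for all `l`, then
`#{t > 0 : det(X^e • (−wwᵀ) + Σ X^{d l} • P l)(t) = 0} ≤ 1` — for EVERY size `m` and number of letters `K`
(`oneLetter_le_one`: `K = 1`).  So all `K`-growth of `Z₊` at `κ = 1` needs `min d < e < max d`.
[folklore] linear algebra; the statement is the line's (val-idea-6 g7).
-/

-- `Summit.ValiantsHypothesis.ValiantsHypothesis.…` is the tree's mandated single-conjunct layout (Sub = Summit).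
set_option linter.dupNamespace false

namespace Summit.ValiantsHypothesis.ValiantsHypothesis.Theorems.LacunarySymmetroidMatrixDescartes.NegSquaresTropical

open Polynomial Matrix Finset
open scoped BigOperators

/-! ## R1 — the extreme-exponent rung, PROVED: `e ≤ min d` or `e ≥ max d` ⇒ `Z₊ ≤ 1` (every `m`, every `K`)

Memo §5 (R1).  For PSD letters `P l` at exponents `d l` and one subtracted square `X^e • wwᵀ` with `e` BELOW all
`d l`: at `t > 0`, `Σ t^{d l} P l − t^e wwᵀ = t^e (Q(t) − wwᵀ)` with `Q(t) = Σ t^{d l − e} P l` Loewner-nondecreasing;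
where `Q` is definite, `det(Q(t) − wwᵀ) = det Q(t)·(1 − wᵀQ(t)⁻¹w)` (matrix determinant lemma, the tree's
`Literature.Analysis.Matrix.det_sub_vecMulVec`) and `σ(t) = wᵀQ(t)⁻¹w` is nonincreasing (the tree's
`dotProduct_inv_mulVec_le`), so the positive zero set `{σ = 1}` is an interval, hence (for a nonzero polynomial) at
most one point; the semidefinite case is handled by a common-kernel argument (no perturbation).  `e` ABOVE all `d l` is
the same statement read at `1/t`.  All [folklore] linear algebra; the statement is the seat's (val-idea-6 g7). -/

section ExtremeExponent

variable {m K : ℕ}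

/-- The rescaled PSD part `Q(t) = Σ_l t^{d l − e} • P l` (natural subtraction in the exponent). -/
def qPart (d : Fin K → ℕ) (e : ℕ) (P : Fin K → Matrix (Fin m) (Fin m) ℝ) (t : ℝ) :
    Matrix (Fin m) (Fin m) ℝ :=
  ∑ l, t ^ (d l - e) • P l

variable (d : Fin K → ℕ) (e : ℕ) (w : Fin m → ℝ) (P : Fin K → Matrix (Fin m) (Fin m) ℝ)

/-- `Q(t)` is positive semidefinite for `t ≥ 0` when the letters are. [folklore] -/
theorem qPart_posSemidef (hP : ∀ l, (P l).PosSemidef) {t : ℝ} (ht : 0 ≤ t) :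
    (qPart d e P t).PosSemidef :=
  Matrix.posSemidef_sum _ fun l _ => (hP l).smul (pow_nonneg ht _)

/-- The quadratic form of `Q(t)`: `vᵀ Q(t) v = Σ_l t^{d l − e} · vᵀ P_l v`. [folklore] -/
theorem dotProduct_qPart_mulVec (v : Fin m → ℝ) (t : ℝ) :
    v ⬝ᵥ (qPart d e P t *ᵥ v) = ∑ l, t ^ (d l - e) * (v ⬝ᵥ (P l *ᵥ v)) := by
  unfold qPart
  rw [Matrix.sum_mulVec, dotProduct_sum]
  simp only [Matrix.smul_mulVec, dotProduct_smul, smul_eq_mul]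

/-- Common kernel: if `vᵀQ(t)v = 0` at one `t > 0` then every `P l` kills `v`. -/
theorem mulVec_eq_zero_of_quad_eq_zero (hP : ∀ l, (P l).PosSemidef) {t : ℝ} (ht : 0 < t) {v : Fin m → ℝ}
    (h : v ⬝ᵥ (qPart d e P t *ᵥ v) = 0) : ∀ l, P l *ᵥ v = 0 := by
  rw [dotProduct_qPart_mulVec] at h
  have hnn : ∀ l ∈ (Finset.univ : Finset (Fin K)), 0 ≤ t ^ (d l - e) * (v ⬝ᵥ (P l *ᵥ v)) := by
    intro l _
    have h := (hP l).dotProduct_mulVec_nonneg v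
    rw [star_trivial] at h
    exact mul_nonneg (pow_nonneg ht.le _) h
  intro l
  have hl := (Finset.sum_eq_zero_iff_of_nonneg hnn).1 h l (Finset.mem_univ l)
  have hq : v ⬝ᵥ (P l *ᵥ v) = 0 := by
    rcases mul_eq_zero.1 hl with h | h
    · exact absurd h (pow_ne_zero _ ht.ne')
    · exact h
  exact ((hP l).dotProduct_mulVec_zero_iff v).1 (by simpa only [star_trivial] using hq)

/-- Hence `Q(t) v = 0` whenever `vᵀ Q(t) v = 0` (`t > 0`). [folklore] -/
theorem qPart_mulVec_eq_zero (hP : ∀ l, (P l).PosSemidef) {t : ℝ} (ht : 0 < t) {v : Fin m → ℝ}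
    (h : v ⬝ᵥ (qPart d e P t *ᵥ v) = 0) (s : ℝ) : qPart d e P s *ᵥ v = 0 := by
  unfold qPart
  rw [Matrix.sum_mulVec]
  exact Finset.sum_eq_zero fun l _ => by
    rw [Matrix.smul_mulVec, mulVec_eq_zero_of_quad_eq_zero d e P hP ht h l, smul_zero]

/-- Definiteness of `Q(t)` at one point propagates to every positive point (common kernel). -/
theorem qPart_posDef_of (hP : ∀ l, (P l).PosSemidef) {t s : ℝ} (hs : 0 < s)
    (hQ : (qPart d e P t).PosDef) : (qPart d e P s).PosDef := by
  refine Matrix.PosDef.of_dotProduct_mulVec_pos (qPart_posSemidef d e P hP hs.le).isHermitian fun v hv => ?_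
  have h0 := (qPart_posSemidef d e P hP hs.le).dotProduct_mulVec_nonneg v
  rw [star_trivial] at h0 ⊢
  rcases h0.lt_or_eq with hlt | heq
  · exact hlt
  · exfalso
    have hz : qPart d e P t *ᵥ v = 0 := qPart_mulVec_eq_zero d e P hP hs heq.symm t
    have h1 := hQ.dotProduct_mulVec_pos hv
    rw [hz, dotProduct_zero] at h1
    exact lt_irrefl _ h1

/-- `Q` is Loewner-nondecreasing on `[0, ∞)`. -/
theorem qPart_sub_posSemidef (hP : ∀ l, (P l).PosSemidef) {s u : ℝ} (hs : 0 ≤ s) (hsu : s ≤ u) :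
    (qPart d e P u - qPart d e P s).PosSemidef := by
  have h : qPart d e P u - qPart d e P s = ∑ l, (u ^ (d l - e) - s ^ (d l - e)) • P l := by
    unfold qPart
    rw [← Finset.sum_sub_distrib]
    exact Finset.sum_congr rfl fun l _ => by rw [sub_smul]
  rw [h]
  exact Matrix.posSemidef_sum _ fun l _ => (hP l).smul (sub_nonneg.2 (pow_le_pow_left₀ hs hsu _))

/-- `(a bᵀ) y = (b·y) a`. [folklore] -/
theorem vecMulVec_mulVec_eq (a b y : Fin m → ℝ) : Matrix.vecMulVec a b *ᵥ y = (b ⬝ᵥ y) • a := by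
  rw [Matrix.vecMulVec_mulVec, op_smul_eq_smul]

/-- **The interval lemma.**  For `0 < s < u < t`: if `det(Q(s) − wwᵀ) = 0` and `det(Q(t) − wwᵀ) = 0` then
`det(Q(u) − wwᵀ) = 0`. -/
theorem det_qPart_sub_eq_zero_between (hP : ∀ l, (P l).PosSemidef) {s u t : ℝ} (hs : 0 < s) (hsu : s < u)
    (hut : u < t) (hds : (qPart d e P s - Matrix.vecMulVec w w).det = 0)
    (hdt : (qPart d e P t - Matrix.vecMulVec w w).det = 0) :
    (qPart d e P u - Matrix.vecMulVec w w).det = 0 := by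
  classical
  have hu : 0 < u := hs.trans hsu
  have ht : 0 < t := hu.trans hut
  by_cases hQ : (qPart d e P u).PosDef
  · -- definite case: `σ(s) = σ(t) = 1`, `σ` nonincreasing, so `σ(u) = 1`
    have hQs : (qPart d e P s).PosDef := qPart_posDef_of d e P hP hs hQ
    have hQt : (qPart d e P t).PosDef := qPart_posDef_of d e P hP ht hQ
    have hus : IsUnit (qPart d e P s).det := (Matrix.isUnit_iff_isUnit_det _).1 hQs.isUnit
    have huu : IsUnit (qPart d e P u).det := (Matrix.isUnit_iff_isUnit_det _).1 hQ.isUnit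
    have hut' : IsUnit (qPart d e P t).det := (Matrix.isUnit_iff_isUnit_det _).1 hQt.isUnit
    rw [Literature.Analysis.Matrix.det_sub_vecMulVec hus] at hds
    rw [Literature.Analysis.Matrix.det_sub_vecMulVec hut'] at hdt
    rw [Literature.Analysis.Matrix.det_sub_vecMulVec huu]
    have h1 : w ⬝ᵥ (qPart d e P s)⁻¹ *ᵥ w = 1 := by
      rcases mul_eq_zero.1 hds with h | h
      · exact absurd h hQs.det_pos.ne'
      · linarith
    have h2 : w ⬝ᵥ (qPart d e P t)⁻¹ *ᵥ w = 1 := by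
      rcases mul_eq_zero.1 hdt with h | h
      · exact absurd h hQt.det_pos.ne'
      · linarith
    have hle1 := Literature.Analysis.Matrix.dotProduct_inv_mulVec_le hQs
      (qPart_sub_posSemidef d e P hP hs.le hsu.le) w
    have hle2 := Literature.Analysis.Matrix.dotProduct_inv_mulVec_le hQ
      (qPart_sub_posSemidef d e P hP hu.le hut.le) w
    have h3 : w ⬝ᵥ (qPart d e P u)⁻¹ *ᵥ w = 1 := le_antisymm (hle1.trans h1.le) (h2.symm.le.trans hle2)
    rw [h3, sub_self, mul_zero]
  · -- semidefinite case: a common kernel vector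
    obtain ⟨z, hz0, hz⟩ : ∃ z : Fin m → ℝ, z ≠ 0 ∧ z ⬝ᵥ (qPart d e P u *ᵥ z) = 0 := by
      by_contra hcon
      refine hQ (Matrix.PosDef.of_dotProduct_mulVec_pos (qPart_posSemidef d e P hP hu.le).isHermitian
        fun v hv => ?_)
      have h0 := (qPart_posSemidef d e P hP hu.le).dotProduct_mulVec_nonneg v
      rw [star_trivial] at h0 ⊢
      exact lt_of_le_of_ne h0 (fun h => hcon ⟨v, hv, h.symm⟩)
    have hQz : ∀ r, qPart d e P r *ᵥ z = 0 := qPart_mulVec_eq_zero d e P hP hu hz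
    obtain ⟨y, hy0, hy⟩ := Matrix.exists_mulVec_eq_zero_iff.2 hds
    rw [Matrix.sub_mulVec, vecMulVec_mulVec_eq, sub_eq_zero] at hy
    -- `hy : Q(s) y = (w·y) w`
    have hsym : (qPart d e P s)ᵀ = qPart d e P s := by
      have h := (qPart_posSemidef d e P hP hs.le).isHermitian.eq
      rwa [Matrix.conjTranspose_eq_transpose_of_trivial] at h
    have hzy : z ⬝ᵥ (qPart d e P s *ᵥ y) = 0 := by
      rw [Matrix.dotProduct_mulVec, ← Matrix.mulVec_transpose, hsym, hQz s, zero_dotProduct]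
    have hprod : (w ⬝ᵥ y) * (z ⬝ᵥ w) = 0 := by
      rw [hy, dotProduct_smul, smul_eq_mul] at hzy
      exact hzy
    rcases mul_eq_zero.1 hprod with h | h
    · -- `w·y = 0`: then `Q(s) y = 0`, `y` is a common kernel vector, and `(Q(u) − wwᵀ) y = 0`
      rw [h, zero_smul] at hy
      have hyq : y ⬝ᵥ (qPart d e P s *ᵥ y) = 0 := by rw [hy, dotProduct_zero]
      have hQy : qPart d e P u *ᵥ y = 0 := qPart_mulVec_eq_zero d e P hP hs hyq u
      refine Matrix.exists_mulVec_eq_zero_iff.1 ⟨y, hy0, ?_⟩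
      rw [Matrix.sub_mulVec, vecMulVec_mulVec_eq, hQy, h, zero_smul, sub_zero]
    · -- `z·w = 0`: then `(Q(u) − wwᵀ) z = 0`
      refine Matrix.exists_mulVec_eq_zero_iff.1 ⟨z, hz0, ?_⟩
      rw [Matrix.sub_mulVec, vecMulVec_mulVec_eq, hQz u, dotProduct_comm, h, zero_smul, sub_zero]

/-- Counting: a real polynomial whose positive zero set is an interval has at most one positive root
(as a point of `roots.toFinset`, which is empty for the zero polynomial). -/
theorem card_posRoots_le_one_of_between (p : ℝ[X])
    (H : ∀ s u t : ℝ, 0 < s → s < u → u < t → p.eval s = 0 → p.eval t = 0 → p.eval u = 0) :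
    (p.roots.toFinset.filter (fun t => 0 < t)).card ≤ 1 := by
  classical
  by_contra hgt
  rw [not_le, Finset.one_lt_card] at hgt
  obtain ⟨a, ha, b, hb, hab⟩ := hgt
  rw [Finset.mem_filter, Multiset.mem_toFinset, Polynomial.mem_roots'] at ha hb
  have key : ∀ s t : ℝ, 0 < s → s < t → p.eval s = 0 → p.eval t = 0 → False := by
    intro s t hs hst hps hpt
    have hinf : Set.Infinite {x : ℝ | p.IsRoot x} :=
      Set.Infinite.mono (fun u hu => H s u t hs hu.1 hu.2 hps hpt) (Set.Ioo_infinite hst)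
    exact ha.1.1 (Polynomial.eq_zero_of_infinite_isRoot p hinf)
  rcases lt_or_gt_of_ne hab with hlt | hlt
  · exact key a b ha.2 hlt ha.1.2 hb.1.2
  · exact key b a hb.2 hlt hb.1.2 ha.1.2

/-- Evaluating the `κ = 1` determinant at a real point. [folklore] -/
theorem eval_det_negOne (t : ℝ) :
    (Matrix.det (((X : ℝ[X]) ^ e) • (-Matrix.vecMulVec w w).map C
        + ∑ l, (X : ℝ[X]) ^ d l • (P l).map C)).eval t
      = (t ^ e • (-Matrix.vecMulVec w w) + ∑ l, t ^ d l • P l).det := by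
  have h := RingHom.map_det (Polynomial.evalRingHom t)
    (((X : ℝ[X]) ^ e) • (-Matrix.vecMulVec w w).map C + ∑ l, (X : ℝ[X]) ^ d l • (P l).map C)
  rw [Polynomial.coe_evalRingHom] at h
  rw [h]
  congr 1
  ext i j
  simp only [RingHom.mapMatrix_apply, Matrix.map_apply, Matrix.add_apply, Matrix.smul_apply, Matrix.sum_apply,
    Matrix.neg_apply, smul_eq_mul, Polynomial.coe_evalRingHom, Polynomial.eval_add, Polynomial.eval_neg,
    Polynomial.eval_mul, Polynomial.eval_pow, Polynomial.eval_X, Polynomial.eval_C, Polynomial.eval_finsetSum,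
    map_neg]

/-- Low exponent: `Σ t^{d l} P l − t^e wwᵀ = t^e • (Q(t) − wwᵀ)`. -/
theorem pencil_eval_eq_low (he : ∀ l, e ≤ d l) (t : ℝ) :
    t ^ e • (-Matrix.vecMulVec w w) + ∑ l, t ^ d l • P l
      = t ^ e • (qPart d e P t - Matrix.vecMulVec w w) := by
  unfold qPart
  rw [smul_sub, Finset.smul_sum, smul_neg, sub_eq_add_neg, add_comm]
  congr 1
  exact Finset.sum_congr rfl fun l _ => by rw [smul_smul, ← pow_add, Nat.add_sub_of_le (he l)]

/-- High exponent: `Σ t^{d l} P l − t^e wwᵀ = t^e • (Q'(1/t) − wwᵀ)` with `Q'(x) = Σ x^{e − d l} P l`. -/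
theorem pencil_eval_eq_high (he : ∀ l, d l ≤ e) {t : ℝ} (ht : t ≠ 0) :
    t ^ e • (-Matrix.vecMulVec w w) + ∑ l, t ^ d l • P l
      = t ^ e • (qPart (fun l => e - d l) 0 P t⁻¹ - Matrix.vecMulVec w w) := by
  unfold qPart
  rw [smul_sub, Finset.smul_sum, smul_neg, sub_eq_add_neg, add_comm]
  congr 1
  refine Finset.sum_congr rfl fun l _ => ?_
  rw [smul_smul, Nat.sub_zero]
  congr 1
  have h1 : t ^ e = t ^ d l * t ^ (e - d l) := by rw [← pow_add, Nat.add_sub_of_le (he l)]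
  rw [h1, mul_assoc, ← mul_pow, mul_inv_cancel₀ ht, one_pow, mul_one]

/-- **R1, low form (kernel).**  `e ≤ d l` for all `l` ⇒ at most ONE positive zero, for every `m` and `K`. -/
theorem extremeExponent_low_le_one (hP : ∀ l, (P l).PosSemidef) (he : ∀ l, e ≤ d l) :
    ((Matrix.det (((X : ℝ[X]) ^ e) • (-Matrix.vecMulVec w w).map C
        + ∑ l, (X : ℝ[X]) ^ d l • (P l).map C)).roots.toFinset.filter (fun t => 0 < t)).card ≤ 1 := by
  classical
  refine card_posRoots_le_one_of_between _ fun s u t hs hsu hut hps hpt => ?_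
  have hu : 0 < u := hs.trans hsu
  have ht : 0 < t := hu.trans hut
  have conv : ∀ x : ℝ, 0 < x →
      ((Matrix.det (((X : ℝ[X]) ^ e) • (-Matrix.vecMulVec w w).map C
        + ∑ l, (X : ℝ[X]) ^ d l • (P l).map C)).eval x = 0
        ↔ (qPart d e P x - Matrix.vecMulVec w w).det = 0) := by
    intro x hx
    rw [eval_det_negOne, pencil_eval_eq_low d e w P he, Matrix.det_smul, Fintype.card_fin, mul_eq_zero,
      or_iff_right (pow_ne_zero _ (pow_ne_zero _ hx.ne'))]
  rw [conv u hu]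
  exact det_qPart_sub_eq_zero_between d e w P hP hs hsu hut ((conv s hs).1 hps) ((conv t ht).1 hpt)

/-- **R1, high form (kernel).**  `d l ≤ e` for all `l` ⇒ at most ONE positive zero (the low form read at `1/t`). -/
theorem extremeExponent_high_le_one (hP : ∀ l, (P l).PosSemidef) (he : ∀ l, d l ≤ e) :
    ((Matrix.det (((X : ℝ[X]) ^ e) • (-Matrix.vecMulVec w w).map C
        + ∑ l, (X : ℝ[X]) ^ d l • (P l).map C)).roots.toFinset.filter (fun t => 0 < t)).card ≤ 1 := by
  classical
  refine card_posRoots_le_one_of_between _ fun s u t hs hsu hut hps hpt => ?_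
  have hu : 0 < u := hs.trans hsu
  have ht : 0 < t := hu.trans hut
  have conv : ∀ x : ℝ, 0 < x →
      ((Matrix.det (((X : ℝ[X]) ^ e) • (-Matrix.vecMulVec w w).map C
        + ∑ l, (X : ℝ[X]) ^ d l • (P l).map C)).eval x = 0
        ↔ (qPart (fun l => e - d l) 0 P x⁻¹ - Matrix.vecMulVec w w).det = 0) := by
    intro x hx
    rw [eval_det_negOne, pencil_eval_eq_high d e w P he hx.ne', Matrix.det_smul, Fintype.card_fin, mul_eq_zero,
      or_iff_right (pow_ne_zero _ (pow_ne_zero _ hx.ne'))]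
  rw [conv u hu]
  -- the three inverted points `t⁻¹ < u⁻¹ < s⁻¹`
  exact det_qPart_sub_eq_zero_between (fun l => e - d l) 0 w P hP (inv_pos.2 ht)
    ((inv_lt_inv₀ ht hu).2 hut) ((inv_lt_inv₀ hu hs).2 hsu) ((conv t ht).1 hpt) ((conv s hs).1 hps)

/-- **R1 (kernel): the extreme-exponent rung of the `κ = 1` law.**  If the subtracted square's exponent `e` is
`≤` every `d l` or `≥` every `d l`, the `κ = 1` determinant has at most one positive zero — for EVERY size `m` and every
number of letters `K` (so all `K`-growth of `Z₊` at `κ = 1` needs `e` strictly inside the exponent range; memo §5). -/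
theorem extremeExponent_le_one (hP : ∀ l, (P l).PosSemidef) (he : (∀ l, e ≤ d l) ∨ (∀ l, d l ≤ e)) :
    ((Matrix.det (((X : ℝ[X]) ^ e) • (-Matrix.vecMulVec w w).map C
        + ∑ l, (X : ℝ[X]) ^ d l • (P l).map C)).roots.toFinset.filter (fun t => 0 < t)).card ≤ 1 := by
  rcases he with he | he
  · exact extremeExponent_low_le_one d e w P hP he
  · exact extremeExponent_high_le_one d e w P hP he


/-- One letter (`K = 1`): the exponent condition is automatic, so `Z₊ ≤ 1` for every `m`. -/
theorem oneLetter_le_one (d : Fin 1 → ℕ) (e : ℕ) (w : Fin m → ℝ) (P : Fin 1 → Matrix (Fin m) (Fin m) ℝ)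
    (hP : ∀ l, (P l).PosSemidef) :
    ((Matrix.det (((X : ℝ[X]) ^ e) • (-Matrix.vecMulVec w w).map C
        + ∑ l, (X : ℝ[X]) ^ d l • (P l).map C)).roots.toFinset.filter (fun t => 0 < t)).card ≤ 1 := by
  refine extremeExponent_le_one d e w P hP ((le_total e (d 0)).imp (fun h l => ?_) (fun h l => ?_))
  · rw [Fin.eq_zero l]; exact h
  · rw [Fin.eq_zero l]; exact h

end ExtremeExponent

end Summit.ValiantsHypothesis.ValiantsHypothesis.Theorems.LacunarySymmetroidMatrixDescartes.NegSquaresTropical
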